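import Summits.HodgeConjecture.HodgeConjecture.Theorems.F0P6aStubKOTT   -- ★ p852867 VERBATIM TWIN (LAST part; part `…F0P6aStubKOTTRows` p852853 rides the import) of tree `Lines/F0_P6a_StubKOTT.lean` ED. 2 4594ebf9aa2bb03a (573 l.; namespace KEPT)
import HarnessLib
import HarnessLib.Audit.LibrarySuggestionsDenyListCruxes

/-! # F0_P6a_StubKOTT — ED. 3 = SHIM (K5-H3 P-lane prerequisite №1, promoted from K6 by LEAD F0P6-plan «M-140b»; pen «L7» LA7-plan (g7), RE-HOME TABLE v1.7; box LAref-P (g5) first ∕ LA-ref1 (g5) second)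

Every declaration of the KOTT leaf ED. 2 (sha16 4594ebf9aa2bb03a, 573 l., sorry-free, stub-free; 19 declarations: `charpoly_eq_prod_of_tupleIsoAt₂`, `kottwitzΩ_of_gen_iso`,
`exists_kottwitzRows_of_gen_iso`, `KottAdaptedAt`, `pelKottLaw_of_gen_iso`, the `Constructor` section (`exists_eq_comp_of_isGalois` … `exists_adapted_frame`), the ED. 2 `Unmixed`
section (`UnmixedAt`, the `Feeds` rows `mOf_…`, `unmixedAt_image_of_unmixed`, `exists_adapted_unmixed_frame`)) now lives, byte for byte and under the SAME namespace
`Summit.HodgeConjecture.HodgeConjecture.Cruxes.HLiu418.F0P6aStubKOTT`, in ★ `Theorems/F0P6aStubKOTTRows.lean` (p852853) → ★ `Theorems/F0P6aStubKOTT.lean` (p852867); this module keeps its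
name so that its tree importers (`F0_P6a_PELInputs.lean` — itself a shim from this same request on — and any by-name reader under `open …F0P6aStubKOTT`) resolve unchanged
through the import above.  It declares nothing.  No declaration was cut in the ★ twin (verbatim re-home) ⇒ nothing to alias.
ORDER NOTE: written in ONE request together with the `F0_P6a_PELInputs` ED. 5 shim and the `F0_P6a_PELSpread` ED. 2 hub edition (NO-CROSS-IMPORT: no environment may hold
a `Lines/` ORIGINAL of this lane together with its ★ twin — MAIN imports `Lines.F0_P6a_PELInputs` directly); an importer smoke that reads «environment already contains …»
before that request is BUILT is this order note, not a defect.  Edition history ED. 1–2 stays in the line card and in git; future changes are ★-side proposals on the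
`Theorems/` files.
HC_CM is proved only modulo the 7 printed citations (2 remaining named inputs: hLiu418 = stmt-HodgeConjecture-24832, h413 = stmt-HodgeConjecture-24833) until rung 0 closes; count-neutral (0 `sorry`, 0 socket, 0 declarations). -/
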